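import Summits.Ventures.Crystal3D.StickySpheres.BarlowLayerBound
import Summits.Ventures.Crystal3D.StickySpheres.TriangularDiscCount
import HarnessLib

/-!
# `(111)`-facet no-gain for restackings registered to the fcc substrate (`RegistryNoGain111`)

HONEST FRAMING. Part of the venture `Summits/Ventures/Crystal3D` (cells `pub-crystal3d`,
`crystal3d-full`). An IN-REGISTRY rung of the cell's K1 atom `NoReconstructionGain111`; nothing
off-lattice, nothing about ground states or three-dimensional crystallization.

**Theorem** (`registry_noGain111`; the statement `RegistryNoGain111` of
HOME/cf-p1/lean/WulffSelection.lean, ROUTE.md §12.4/§16, with the cell's `registeredStacking σ m`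
written out as the translate `m·w + barlowStacking 1 √(2/3) σ` (`w = barlowOffset 1`) and
`deficiency x` as `6N − numContacts x`).  With `R = 2`, `C = 8√3·π`: for every `ρ ≥ R` and every
unit packing `x : Fin N → ℝ³` that (i) is drawn from ONE Barlow stacking registered to the fcc
lattice `Λ₀ = fccStacking 1 √(2/3)` along `e₃` (any Hägg word `σ`, any lateral class `m`) and
(ii) contains the fcc `(111)` slab sample of lateral radius `ρ` between heights `−2R` and `−R`,
`2√3·π·ρ² − C·ρ ≤ 6N − numContacts x`: restacking the substrate above the sample (islands,
terraces, pits, adatoms in hollow sites, any word) does not gain contacts at order area over the two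
flat `(111)` faces.

Proof: the translated layer bound (`BarlowLayerBound.lean`) at layer `−3`: the fcc sample sites of
layer `−3` (height `−3√(2/3) ∈ [−4, −2]`) are balls of `x`, hence sites of the registered
stacking's layer `−3`, and they number `≥ (2/√3)π(ρ − 2)²` (`TriangularDiscCount.lean`).

WHAT THIS IS NOT: not `NoReconstructionGain111` (off-lattice, OPEN); rung F-C1 of the cell is not
moved by an in-registry lemma.
-/

noncomputable section

namespace Summit.Ventures.Crystal3D

open Finset
open Literature.MathematicalPhysics.StatisticalMechanics (barlowPos barlowLayer barlowStacking
  fccStacking constHagg isHaggSeq_const haggLabel haggLabel_const barlowOffset IsHaggSeq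
  barlowPos_mem barlowPos_apply_zero barlowPos_apply_one barlowPos_apply_two
  le_dist_barlowPos_of_ideal)

/-- **`RegistryNoGain111` (in-registry `(111)` no-gain).** With `R = 2` and `C = 8√3π`: for
`ρ ≥ R` and a unit packing `x` lying on a translate `m·barlowOffset 1 + barlowStacking 1 √(2/3) σ`
(`σ` a Hägg sequence, `m : ℕ`) and containing the fcc slab sample of radius `ρ`
(`−2R ≤ p₂ ≤ −R`, `p₀² + p₁² ≤ ρ²`), `2√3·π·ρ² − C·ρ ≤ 6N − numContacts x`. -/
theorem registry_noGain111 :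
    ∃ R C : ℝ, 0 < R ∧
      ∀ ρ : ℝ, R ≤ ρ → ∀ (N : ℕ) (x : Fin N → EuclideanSpace ℝ (Fin 3)), IsUnitPacking x →
        (∃ σ : ℤ → ℤ, ∃ m : ℕ, IsHaggSeq σ ∧
            ∀ i, x i ∈ (fun p => p + (m : ℝ) • barlowOffset 1) ''
              barlowStacking 1 (Real.sqrt (2 / 3)) σ) →
        (∀ p ∈ fccStacking 1 (Real.sqrt (2 / 3)),
            -(2 * R) ≤ p 2 → p 2 ≤ -R → p 0 ^ 2 + p 1 ^ 2 ≤ ρ ^ 2 → ∃ i, x i = p) →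
          2 * Real.sqrt 3 * Real.pi * ρ ^ 2 - C * ρ ≤ 6 * (N : ℝ) - (numContacts x : ℝ) := by
  classical
  refine ⟨2, 8 * Real.sqrt 3 * Real.pi, by norm_num, ?_⟩
  rintro ρ hρ N x hx ⟨σ, m, hσ, hreg⟩ hsample
  have h3 : (0 : ℝ) < Real.sqrt 3 := Real.sqrt_pos.2 (by norm_num)
  have h3sq : Real.sqrt 3 ^ 2 = 3 := Real.sq_sqrt (by norm_num)
  have hh : (Real.sqrt (2 / 3)) ^ 2 = 2 / 3 * (1 : ℝ) ^ 2 := by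
    rw [Real.sq_sqrt (by norm_num)]; ring
  have hhpos : 0 < Real.sqrt (2 / 3) := Real.sqrt_pos.2 (by norm_num)
  have hlow : (2 : ℝ) / 3 ≤ Real.sqrt (2 / 3) := by
    nlinarith [Real.sq_sqrt (show (0 : ℝ) ≤ 2 / 3 by norm_num), Real.sqrt_nonneg (2 / 3)]
  have hhigh : Real.sqrt (2 / 3) ≤ 1 := Real.sqrt_le_one.mpr (by norm_num)
  -- the packing lives on the translate `v + stacking`
  set v : EuclideanSpace ℝ (Fin 3) := (m : ℝ) • barlowOffset 1 with hv
  have hv2 : v 2 = 0 := by simp [hv, barlowOffset]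
  have hmem : ∀ i, x i - v ∈ barlowStacking 1 (Real.sqrt (2 / 3)) σ := by
    intro i
    obtain ⟨q, hq, hqx⟩ := hreg i
    have : x i - v = q := by rw [← hqx]; simp [hv]
    rw [this]; exact hq
  -- coordinates on the registered stacking
  have hcoord : ∀ i, ∃ k a b : ℤ, x i - v = barlowPos 1 (Real.sqrt (2 / 3)) σ k a b :=
    fun i => hmem i
  choose k a b hc using hcoord
  -- equal fcc positions have equal coordinates
  have hfcc_inj : ∀ {k₁ a₁ b₁ k₂ a₂ b₂ : ℤ},
      barlowPos 1 (Real.sqrt (2 / 3)) constHagg k₁ a₁ b₁ =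
        barlowPos 1 (Real.sqrt (2 / 3)) constHagg k₂ a₂ b₂ → (k₁, a₁, b₁) = (k₂, a₂, b₂) := by
    intro k₁ a₁ b₁ k₂ a₂ b₂ heq
    by_contra hne
    have h1 := le_dist_barlowPos_of_ideal isHaggSeq_const one_pos hh hne
    rw [heq, dist_self] at h1
    exact absurd h1 (by norm_num)
  -- the translated layer bound at `l = -3`
  set E := univ.filter fun i => x i - v ∈ barlowLayer 1 (Real.sqrt (2 / 3)) σ (-3) with hE
  have hlayer := three_mul_card_layer_add_numContacts_le_of_sub_mem σ hσ x hx v hmem (-3)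
  -- balls that ARE fcc sites of layer `-3` sit in the registered stacking's layer `-3`
  set E' := univ.filter fun i =>
    ∃ ab : ℤ × ℤ, x i = barlowPos 1 (Real.sqrt (2 / 3)) constHagg (-3) ab.1 ab.2 with hE'
  have hE'E : E' ⊆ E := by
    intro i hi
    rw [hE', mem_filter] at hi
    obtain ⟨ab, hab⟩ := hi.2
    rw [hE, mem_filter]
    refine ⟨mem_univ _, a i, b i, ?_⟩
    -- the layer index of `x i - v` is `-3` since heights agree
    have hz : (x i - v) 2 = -3 * Real.sqrt (2 / 3) := by
      rw [show (x i - v) 2 = x i 2 - v 2 from rfl, hv2, hab, barlowPos_apply_two]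
      push_cast; ring
    have hk : k i = -3 := by
      rw [hc i, barlowPos_apply_two] at hz
      have : ((k i : ℝ) - (-3)) * Real.sqrt (2 / 3) = 0 := by linarith
      rcases mul_eq_zero.1 this with h0 | h0
      · exact_mod_cast (sub_eq_zero.1 h0)
      · exact absurd h0 hhpos.ne'
    rw [hc i, hk]
  -- fcc coordinates of the fcc balls, and the disc they contain
  set g : Fin N → ℤ × ℤ := fun i =>
    if h : ∃ ab : ℤ × ℤ, x i = barlowPos 1 (Real.sqrt (2 / 3)) constHagg (-3) ab.1 ab.2
    then h.choose else (0, 0) with hg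
  set T : Finset (ℤ × ℤ) := E'.image g with hT
  have hTE : T.card ≤ E.card := card_image_le.trans (card_le_card hE'E)
  have hdisc := triangular_disc_count ((3 : ℝ) / 2) (Real.sqrt 3 / 2) ρ hρ T ?_
  swap
  · intro i j hcond
    set p := barlowPos 1 (Real.sqrt (2 / 3)) constHagg (-3) i j with hp
    have hp2 : p 2 = -3 * Real.sqrt (2 / 3) := by
      rw [hp, barlowPos_apply_two]; push_cast; ring
    have hp0 : p 0 = (i : ℝ) + (j : ℝ) / 2 - 3 / 2 := by
      rw [hp, barlowPos_apply_zero, haggLabel_const]; push_cast; ring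
    have hp1 : p 1 = Real.sqrt 3 / 2 * (j : ℝ) - Real.sqrt 3 / 2 := by
      rw [hp, barlowPos_apply_one, haggLabel_const]; push_cast; ring
    obtain ⟨i', hi'⟩ := hsample p (barlowPos_mem _ _ _) (by rw [hp2]; nlinarith)
      (by rw [hp2]; nlinarith) (by rw [hp0, hp1]; nlinarith [hcond])
    have hex : ∃ ab : ℤ × ℤ, x i' = barlowPos 1 (Real.sqrt (2 / 3)) constHagg (-3) ab.1 ab.2 :=
      ⟨(i, j), hi'⟩
    have hi'E : i' ∈ E' := by
      rw [hE', mem_filter]; exact ⟨mem_univ _, hex⟩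
    have hgi : g i' = (i, j) := by
      have hspec := hex.choose_spec
      have := hfcc_inj (hi'.symm.trans hspec)
      simp only [Prod.mk.injEq] at this
      rw [hg]; simp only [hex, dif_pos]
      exact Prod.ext this.2.1.symm this.2.2.symm
    rw [hT, mem_image]
    exact ⟨i', hi'E, hgi⟩
  -- assemble
  have hE' : 3 * (E.card : ℝ) + (numContacts x : ℝ) ≤ 6 * (N : ℝ) := by exact_mod_cast hlayer
  have hTE' : (T.card : ℝ) ≤ (E.card : ℝ) := by exact_mod_cast hTE
  have hkey : 3 * (2 / Real.sqrt 3 * Real.pi * (ρ - 2) ^ 2) =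
      2 * Real.sqrt 3 * Real.pi * ρ ^ 2 - 8 * Real.sqrt 3 * Real.pi * ρ +
        8 * Real.sqrt 3 * Real.pi := by
    field_simp
    nlinarith [h3sq]
  have hpos : 0 ≤ 8 * Real.sqrt 3 * Real.pi := by positivity
  nlinarith [hdisc, hkey, Real.pi_pos]

end Summit.Ventures.Crystal3D

end
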